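import Literature.NumberTheory.Rogawski1990.ArchTransfersSingularOfCanonicalClosedOf
import Literature.NumberTheory.Rogawski1990.UnitFundamentalLemmaExplicitNonsplitClosedProof
import Literature.NumberTheory.Rogawski1990.ArchCentralLimitCornerRegularityOfJetBounds
import Literature.Geometry.ComplexHyperbolic.UnitBallLieAlgebraChamberJets
import Summits.HodgeConjecture.HodgeConjecture.Cruxes.H413.Lines.F0_U3LettersRung1Defs          -- companion ED. 4 «#175 PINNED» (`Rung0WitnessS.hSET` AT `Δ‴(μω)`); ED. 3 (af5b824eed5e58b2): `K9SpectralLetterSigned … c wXi …`, `OverrideWitnessS … c wXi …`, `Rung0WitnessS` (+ `wXi`, `hw`), `Q_K9S` — closer ED. 38 «PK-ε»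
import Summits.HodgeConjecture.HodgeConjecture.Theorems.F0P3ArchTopFormWallCompatibleHolds
import Summits.HodgeConjecture.HodgeConjecture.Theorems.F0P3ArchUniversalPinRatioOfWallCompatible
import Summits.HodgeConjecture.HodgeConjecture.Theorems.F0P3Rung0OfLettersNormalisedPinned          -- ED. 7 «#175 PINNED»: ★ T1 twin `rung0Data_of_letters_normalisedPinned` (dcaeea100baa72d4; S1′ normalised-closed PINNED, `hSET` conjunct `…CanonicalPinned`)
import HarnessLib

/-!
# `F0_U3LettersRung1KitRung0` — KIT R0 of the RUNG-1 LINE `F0_U3LettersRung1` after the «SPLIT» (cell rule s937 (R2) «split the monster per letter behind a thin registered aggregator»; desk D47 (4); LEAD T10-35; REF1 (g24) m09 (R-1)–(R-7); registrar m07; pen F0P3-p04 (g12) proposal v0 4edaab76ecd27ca7, generator `work/ed34/mk_split.py` on the closer ED. 33 of record c227472e30be8b7b).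
EDITION 8 (2026-09-04; «F11 ⊕ F12 — TUPLE CHAIN ANISOTROPIC + μ|ω» — director (g38) s1990 RULING F11 «ANISOTROPY IN THE TUPLE CHAIN» ADOPTED IN SUBSTANCE (ORDER OF WORK (1)–(3)); S7 dealer LH7-plan (g4) RULING S7-R10 (F12 `hμω` FOLDED) ∕ 16:17:22Z ∕ 16:22:03Z; heir LEAD F0P3a-plan (g21) T20-24 (S7 WRITE WINDOW: T-A ED. 5 + KitRung0 ED. 8 → leaf `F0_P3c_PKtuplePaydown` ED. 6 (LH7 pen) + T-B ED. 5 → AGG ED. 46 → ONE KICK); flags F11 (LH7-audit1 (g0) ∕ LH7-typ1 (g2): rg 0 hits for `PosDef|IsAnisotropic|hanis` in the tuple letters; print §14.5 p. 239 «Since G′ is anisotropic») and F12 (LH7-audit1: `μ|_{I_F} = ω_{E∕F}` [§12.1 p. 171] follows from `hquad` only via class field theory — an honest print hypothesis, already a binder of `StubRung0SPinned` ∕ `Rung0WitnessS`); §12.1 page digit p. 171 per lit4 (g13) D-CITE (1829)(a); pen dealer∕pen LH4-plan (g14), generator `F0/P3c/LH4/LH4-plan/g14/f11/mk_f11.py`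 over the tree bytes): `def K9STFSvStatement` and `def K9vStatement` gain the two print binders `(hdef : ∀ τ', InfinitePlace.mk τ' ≠ InfinitePlace.mk ι → (H.map τ').PosDef) (h2 : 2 ≤ Module.finrank ℚ ↥(maximalRealSubfield L))` (= AGG :504 ∕ `KitRung0.rung0_of_letters_pinned` :348 bytes) IMMEDIATELY after the `hT` binder and `(hμω : ∀ x, μω (AdeleRing.ideleBaseChange (↥(maximalRealSubfield L)) L x) = quadraticHeckeCharCM L x)` (= Defs :689–:690 bytes) IMMEDIATELY after the `hμu` binder; the ONE call site `Kit.rung0_of_letters_pinned` :368 `hK9v L ι H T hT μ μω hμu ν …` ↦ `hK9v L ι H T hT hdef h2 μ μω hμu hμω ν …` — consumer-legal: :348 already reads `intro L _ _ _ ι H T hT hdef h2 μ _ μω hμu hμω` (`StubRung0SPinned` UNCHANGED, `hanis` still DERIVED at :350 by ★ `anisotropic_of_frame`, no `hanis` binder (C4)).  Every other byte of ED. 7 stands (imports 9∕9, `rung0_of_letters_pinned`՚s body otherwise verbatim, all other statements).  SORRY-FREE; axioms TRIO.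

EDITION 7 (2026-09-03, «#175 PINNED» — closer ED. 44; director g36 s1830 ORDER «re-letter #175 at AGG ED. 44»; heir LEAD F0P3a-plan (g19) T18-10 «#175-R SCOPE» (1)(c) T4 ∕ T18-13 (3); desk F0P3-plan (g22)
D-O7∕D-O7b; K2E4-r01 (g0) O7 VERDICT 9d20d85d782e07ce: letter #175 `stub_S1finTFCovol` MISSTATED AS TYPED on the weak frame (its `∀ Δ`); registrar A-plan1 (g34) pen; base ED. 6 ec9cb02fb8ceac59).
WHAT CHANGES: (i) import ★ `Theorems.F0P3Rung0OfLettersNormalisedPinned` (T1 twin) INSTEAD OF ★ `…F0P3Rung0OfLettersNormalised`; (ii) `Kit.rung0_of_letters_pinned`: binder `hS1n` re-typed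
★ `TamagawaSingularMembersExistNormalisedClosedPinned` (registrar L2 ★ p855290: S1′ normalised-closed with `Δ` PINNED to print՚s `Δ‴(μω)`, `Tinf` to `Δ‴_∞(μω)`) and its data drawn from
★ `F0P3Rung0OfLettersNormalisedPinned.rung0Data_of_letters_normalisedPinned` (same argument list) — whose `hSET` conjunct ★ `SingularEllipticTransferCanonicalPinned L H μω …` IS the
re-typed field `Rung0WitnessS.hSET` of Defs ED. 4 by δ (`…Pinned := …AtDelta _ _ (archCanonicalTransferFactor L H μω) (finExplicitCollection L H μω …)`, and the record sets
`Tinf := archCanonicalTransferFactor L H μω`); body otherwise byte-identical; (iii) `Kit.rung0_of_letters` (the UNPINNED producer of `StubRung0S`, fed by the `∀ Δ` letter) is DROPPED —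
its only consumer, the aggregator՚s `stub_rung0`, goes at closer ED. 44 (nothing downstream reads `StubRung0S`: rg over `Cruxes/H413/Lines` + `Theorems`).  UNCHANGED BYTE-FOR-BYTE:
`StubRung0SPinned`, the closed rows, the statement defs, `Kit.l21_of_A6lim`, `Kit.a6lim_of_jets`.  NO `sorry`, NO registered row.

EDITION 5 (2026-09-01; closer ED. 38 «PK-ε» — desk F0P3-plan (g12) RULING D53-pre A(2) + (10)(11), census B1 (c) 9c22b97a2bccd400; pen of record F0P3-p04 (g13), generator `work/ed38/mk_ed38_kitr0.py` over the tree ED. 4 bytes 518120892213a37f): the DERIVED-row texts `K9STFSvStatement`∕`K9vStatement` carry the per-ξ global ROOT NUMBER — ∃ `(c : ℚ) (wXi : OneDimAutRepH L → ℤ) (jInf dsInf …)` with the law `(∀ ξ, wXi ξ = 1 ∨ wXi ξ = -1)` [Rogawski1992 Thm. 1.2; §6 p. 417], `K9SpectralLetterSigned … c wXi jInf dsInf` ∕ `OverrideWitnessS … c wXi jInf dsInf …` (Defs ED. 3 binder order); `Kit.rung0_of_letters` threads `wXi`∕`hw` into the `Rung0WitnessS` it builds (`Q_K9S … c wXi …`,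 fields `wXi := wXi`, `hw := hw`).  UNCHANGED BYTE-FOR-BYTE: the closed rows `stub_Sc`∕`stub_N7ns`∕`stub_N7`∕`stub_WallCompat`∕`stub_U`, `N8Statement`, `N9Statement`, `QCMTSStatement` (P3b desk (g20) layer-R-B acceptance condition: its VALUE text 91523cc23750014f and `stub_WallCompat` :77 stand), `Kit.l21_of_A6lim`, `Kit.a6lim_of_jets`.  NO `sorry`, NO registered row.

EDITION 1 (2026-09-01).  CONTENT: (i) BYTE-VERBATIM from the closer ED. 33 chunk §B: the preamble of `section Rung0` and the CLOSED rows `stub_Sc` (:694–:697), `stub_N7ns` (:719–:723), `stub_N7` (:725–:728),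
`stub_WallCompat` (:742–:751), `stub_U` (:753–:807); (ii) NEW named statements (R-2∕R-3: token-identical copies of the ED. 33 texts, used ONLY as kit hypothesis∕conclusion types — the REGISTERED rows
keep their LITERAL texts in the aggregator): `N8Statement` (= `stub_N8`՚s text), `N9Statement`, `QCMTSStatement` (= derived `stub_QCMTS`՚s), `K9STFSvStatement` (= derived `stub_K9STFSv`՚s), `K9vStatement` (= derived `stub_K9v`՚s);
(iii) NEW `Kit.rung0_of_letters (hN8 : N8Statement) (hN9 : N9Statement) (hSd : ArchCentralValueTransferExistsClosed) (hN6 : LocalTransferExplicitClosed) (hS1n : TamagawaSingularMembersExistNormalisedClosed)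
(hQ : QCMTSStatement) (hK9v : K9vStatement) : StubRung0S` = the ED. 33 body of `stub_rung0` (:1035–:1066) with the seven cone rows as BINDERS (the closed `stub_Sc`∕`stub_N7` used by name) — FUNCTION FORM, so the
aggregator՚s `stub_rung0 := Kit.rung0_of_letters stub_N8 stub_N9 stub_Sd stub_N6 stub_S1n stub_QCMTS stub_K9v` is ONE line (δ-unfolding of the statement defs against the literal row texts).
NO `sorry`, NO registered row, no `instance`, no notation.
HONEST LABEL: engineering only — nothing is discharged by the split; HC_CM is proved only modulo the 2 remaining named inputs (hLiu418, h413) until rung 0 closes.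
-/

set_option autoImplicit false
set_option linter.dupNamespace false

noncomputable section

namespace Summit.HodgeConjecture.HodgeConjecture.Cruxes.H413.F0U3LettersRung1

open MeasureTheory NumberField IsDedekindDomain
open Literature.NumberTheory.Automorphic Literature.NumberTheory.Automorphic.UnitaryGroup
open Literature.NumberTheory.Rogawski1990 Literature.NumberTheory.GaloisRepresentations
open Summit.HodgeConjecture.HodgeConjecture.Cruxes.H413
open Summit.HodgeConjecture.HodgeConjecture.Cruxes.H413.F0T1InnerFormTraceIdentity (ComparisonKit SpecOverride GpAdelic GpLocal HLocal GpInf GInf HInf IsAnisotropic)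
open Summit.HodgeConjecture.HodgeConjecture.Cruxes.H413.F0P3InnerFormClassificationV6 (Gp Places Cinf EvpData)
open Summit.HodgeConjecture.HodgeConjecture.Cruxes.H413.F0P3KitOfRecord (kitOfRecord GHSide socketsOfT1)
open Summit.HodgeConjecture.HodgeConjecture.Cruxes.H413.F0P3XiSideOfRecord (xiSideOfRecord)
open Summit.HodgeConjecture.HodgeConjecture.Cruxes.H413.F0P3XiPacketFamilyOfRecord (keysOfKeysCaseTwo hCM_of_cmCharIdentityPackage hexc_of_xiPinSphericalCofinite)
open Summit.HodgeConjecture.HodgeConjecture.Cruxes.H413.F0P3XiArchPacketOfRecord (JInfNoDegOne DsInfNoDegOne)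
open Summit.HodgeConjecture.HodgeConjecture.Cruxes.H413.F0P3UnitaryLocOfRecord (IsCohUnitaryClass)
open Summit.HodgeConjecture.HodgeConjecture.Cruxes.H413.F0P3LettersTraceFactorisation (IsProductHaar)
open scoped Matrix ComplexOrder

section Rung0

variable (L : Type) [Field L] [NumberField L] [IsCMField L] (ι : L →+* ℂ) (H : Matrix (Fin 3) (Fin 3) L) (T : GL (Fin 3) ℂ)
  (hT : (T : Matrix (Fin 3) (Fin 3) ℂ)ᴴ * H.map ι * (T : Matrix (Fin 3) (Fin 3) ℂ) = Literature.Geometry.ComplexHyperbolic.BallModel.J)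
  (μ : Measure (Gp L H).automorphicQuotient) [(Gp L H).IsAutomorphicMeasure μ] (μω : HeckeCharacter L) (hμu : μω.IsUnitary)
  (hμω : ∀ x : Literature.NumberTheory.GaloisRepresentations.ideleGroup ↥(maximalRealSubfield L), μω (AdeleRing.ideleBaseChange (↥(maximalRealSubfield L)) L x) = quadraticHeckeCharCM L x)

/-! ### (R0-closed) THE CLOSED RUNG-0 ROWS (verbatim from the closer ED. 33) -/

/-- STUB (S-c) — CLOSED (ED. 23, desk F0P3-plan (g8) RULING D25) over ★ `Literature.NumberTheory.Rogawski1990.archTransfersSingularOfCanonicalClosed_of_centralVanishing` — the singular-class behaviour of §14.5 from the canonical transfers = ★ `ArchTransfersSingularOfCanonicalClosed` BY NAME.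
[cite: Rogawski1990, §14.5 Lemma 14.5.2 (c) p. 238] -/
theorem stub_Sc : ArchTransfersSingularOfCanonicalClosed :=
  Literature.NumberTheory.Rogawski1990.archTransfersSingularOfCanonicalClosed_of_centralVanishing

/-- [CLOSED at ED. 24 (2026-09-01, desk F0P3-plan (g8) RULING D26) over ★ `Literature.NumberTheory.Rogawski1990.unitFundamentalLemmaExplicitNonsplitClosed_holds` — ★ p842433, F0P3a-p04 (g13) port of the «N7nsCount» line ED. 1.7 (A-p06 (g26) architect; LEAD T8-161 (2))] **REGISTERED PRINT STUB `stub_N7ns` (NEW, hunk (ns7)) — LETTER N7, NON-SPLIT HALF** = ★ `UnitFundamentalLemmaExplicitNonsplitClosed` BY NAME (F0P3-p01 p839598): Prop. 4.9.1 (b) at the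
non-split finite places, [BR₁]; the split half is ★ p839848 ∕ ★ p839938; books #103 ↦ «N7-ns».
[cite: Rogawski1990, §4.9 Prop. 4.9.1 (b) p. 55; §14.6 p. 242] [cite: BlasiusRogawski1992, Thm. 1] -/
theorem stub_N7ns : Literature.NumberTheory.Rogawski1990.UnitFundamentalLemmaExplicitNonsplitClosed :=
  Literature.NumberTheory.Rogawski1990.unitFundamentalLemmaExplicitNonsplitClosed_holds

/-- STUB N7 (#103) — **CLOSED (hunk (ns7))** over the NEW letter stub `stub_N7ns` by ★ `unitFundamentalLemmaExplicitClosed_of_nonsplitClosed` (F0P3-p01 p839938; split half PROVED in-house).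
[cite: Rogawski1990, §4.9 Prop. 4.9.1 (b) p. 55] -/
theorem stub_N7 : UnitFundamentalLemmaExplicitClosed :=
  unitFundamentalLemmaExplicitClosed_of_nonsplitClosed stub_N7ns

/-- **STUB `stub_WallCompat` — CLOSED (ED. 31 «WallCompat PAID», desk F0P3-plan (g10) RULING D41) BY NAME `:= fun L _ _ _ => …F0P3ArchTopFormWallCompatibleHolds.archTopFormWallCompatible_holds L` over ★ p844988 `Theorems/F0P3ArchTopFormWallCompatibleHolds.lean` (A-p19 (g24): U4 PROVED IN-HOUSE, no hypotheses, TRIO; = ★ p844954 U4 ⟸ (W2′) + ★ p844963 rank-one germ limit (F0P3-p03 (g12)) + ★ p844953 `π·C = V₂` (A-p06 (g29))); NO `sorry` here; was the REGISTERED in-house row 0fc6f0a3c31d862a of ED. 29–30 (#177, now CLOSED ★) — ARCHIMEDEAN TOP-FORM WALL COMPATIBILITY (U4): ★ route-side def `F0P3ArchTopFormWallCompatible.ArchTopFormWallCompatible`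
(p844462, A-p19 (g24); REF1 (g10) m17 audit A1–A6 PASS) BY NAME at every CM field `L` — ONE constant `V ≠ 0` such that at every complex place `w` and every real non-degenerate diagonal carrier `β`:
(cpt) at a compact `{0,2}`-wall the local top-form wall-block measure `θ^TF_w(β) = (μ^TF_2(diag(β₀,β₂)) ⊗ μ^TF_1((β₁)))_* ι_w` has total mass `V`; (nc) at a noncompact wall it satisfies the (J-nc) clause of
★ `ArchLimitFormulaNoncompactWall L β w` with constant `−V`.  HONEST LABEL: an IN-HOUSE normalisation statement of the project (the (U) road՚s hypothesis (COMPAT)), NOT a printed theorem and NOT a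
Literature fact (LEAD T9-36 (3) ∕ T9-37 (3)); the former registered row `stub_U` (#176, ED. 28) is DERIVED from it just below by ★ p844617.  Its own discharge (the VALUES: (cpt) congruence transport of
★ `localTopFormHaar`, F0P3-p03 (g11) (d2) + A-p06 (g29); (nc) the (J-nc) constant, A-p19 (g24) ∕ A-p12) is a later one-token edition `stub_WallCompat := ‹★›`.  Books: #176 (U) ↦ CLOSED-DERIVED; this row NEW
(in-house).  [anchor — motivated by, NOT a citation of a printed statement: Rogawski1990, §8.2 proof of Prop. 8.2.1, p. 118 ll. 15–22 («Assume that compatible measure on H and H′ are used … the constant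
in the limit formula for H′ differs by a sign from that in the limit formula for H»); §1.7 p. 6 (compatible measures, `dg = |Ω|_v`)] -/
theorem stub_WallCompat : ∀ (L : Type) [Field L] [NumberField L] [IsCMField L], Summit.HodgeConjecture.HodgeConjecture.Cruxes.H413.F0P3ArchTopFormWallCompatible.ArchTopFormWallCompatible L :=
  fun L _ _ _ => Summit.HodgeConjecture.HodgeConjecture.Cruxes.H413.F0P3ArchTopFormWallCompatibleHolds.archTopFormWallCompatible_holds L

open NumberField.InfinitePlace NumberField.mixedEmbedding Filter Topology Equiv Function Set Literature.MeasureTheory.Group Literature.LinearAlgebra.Matrix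
  Literature.NumberTheory.Weil1964 Literature.NumberTheory.Weil1964.UnitaryArchTopForm Literature.NumberTheory.Rogawski1990 in
open scoped Classical MatrixGroups Matrix.Norms.Operator ContDiff NNReal ENNReal Topology in
/-- **STUB `stub_U` — CLOSED (ED. 29 «U PAID», desk F0P3-plan (g10) RULINGS D37∕D38) over the NEW registered in-house row `stub_WallCompat` by ★ `archSingularUniversalPinRatio_of_wallCompatible` (p844617, A-p19 (g24) ROAD (U) FINAL, TRIO; REF1 (g10) m24 fold certificate); NO `sorry` here; was the REGISTERED row cab4514b1e0e6144 of ED. 28 «S1 ⟸ FIN-TF + U» — THE UNIVERSAL ARCHIMEDEAN PIN RATIO (U)**, INLINE-typed: the `hU` binder of ★ `tamagawaSingularMembersExistClosed_of_finTF_of_U`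
(p844326) VERBATIM = ★ (W4f) p844053's `hU` body closed over every CM field `L`, real diagonal carrier `α′`, reference wall `z₁` and the σ-algebras it reads, ONE constant `K ≠ 0` per instance.
HONEST LABEL: NOT a printed statement (review p844247: «a project hypothesis; keep as binder or prove») — its in-house discharge is ROAD (U) (A-p19 (g24): U4
`ArchTopFormWallCompatible` per place [Rogawski1990 §8.2 p. 118 ll. 15–22 «compatible measures … the constant for H′ differs by a sign»] + U3 bridge + U5, LEAD T9-36) — FOLDED at
ED. 29: `stub_U := fun L _ _ _ => ‹★ p844617› L (stub_WallCompat L)`; what remains open is `stub_WallCompat` (U4).  Books: #88's (J-val-K) sub-entry ↦ #176 (U) ↦ CLOSED-DERIVED at ED. 29. [anchor — motivated by, NOT a citation of a printed statement (LEAD T9-37 (3); REF1 (g10) n-U-2): Rogawski1990, §8.2 Prop. 8.2.1 and p. 118 ll. 15–22; §1.7 p. 6; §14.5 Lemma 14.5.2 (b) p. 239] -/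
theorem stub_U : ∀ (L : Type) [Field L] [NumberField L] [IsCMField L],
      ∀ [MeasurableSpace (GL (Fin 3) ℂ)] [BorelSpace (GL (Fin 3) ℂ)]
      (α' : Fin 3 → L) (_hα' : ∀ i, α' i ≠ 0) (_hhermα : ∀ i, (IsCMField.complexConj L (α' i) : L) = α' i)
      [MeasurableSpace (arch (↥(maximalRealSubfield L)) L (IsCMField.complexConj L) 3 (Matrix.diagonal α'))] [BorelSpace (arch (↥(maximalRealSubfield L)) L (IsCMField.complexConj L) 3 (Matrix.diagonal α'))]
      (z₁ : {w : InfinitePlace L // IsComplex w} → Fin 3 → Circle) (h02 : ∀ w, z₁ w 0 = z₁ w 2) (h01 : ∀ w, z₁ w 0 ≠ z₁ w 1)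
      [∀ (w : {w : InfinitePlace L // IsComplex w}) (τ : Perm (Fin 3)), MeasurableSpace (archLocal L 3 (Matrix.diagonal (α' ∘ ⇑τ)) w ⧸ Subgroup.centralizer ({(⟨circleDiagonal 3 (z₁ w), circleDiagonal_mem_archLocal_diagonal L 3 (α' ∘ ⇑τ) w (z₁ w)⟩ : archLocal L 3 (Matrix.diagonal (α' ∘ ⇑τ)) w)} : Set (archLocal L 3 (Matrix.diagonal (α' ∘ ⇑τ)) w)))]
      [∀ (w : {w : InfinitePlace L // IsComplex w}) (τ : Perm (Fin 3)), BorelSpace (archLocal L 3 (Matrix.diagonal (α' ∘ ⇑τ)) w ⧸ Subgroup.centralizer ({(⟨circleDiagonal 3 (z₁ w), circleDiagonal_mem_archLocal_diagonal L 3 (α' ∘ ⇑τ) w (z₁ w)⟩ : archLocal L 3 (Matrix.diagonal (α' ∘ ⇑τ)) w)} : Set (archLocal L 3 (Matrix.diagonal (α' ∘ ⇑τ)) w)))],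
      ∃ K : ℝ≥0, K ≠ 0 ∧
      ∀ (νH : ∀ (w : {w : InfinitePlace L // IsComplex w}) (τ : Perm (Fin 3)), Measure (Subgroup.centralizer ({(⟨circleDiagonal 3 (z₁ w), circleDiagonal_mem_archLocal_diagonal L 3 (α' ∘ ⇑τ) w (z₁ w)⟩ : archLocal L 3 (Matrix.diagonal (α' ∘ ⇑τ)) w)} : Set (archLocal L 3 (Matrix.diagonal (α' ∘ ⇑τ)) w))))
      (hνH : ∀ w τ, (νH w τ).IsHaarMeasure ∧ (νH w τ).IsInvInvariant)
      (hpin : ∀ (w : {w : InfinitePlace L // IsComplex w}) (τ : Perm (Fin 3)), (w.1.embedding (α' (τ 0))).re * (w.1.embedding (α' (τ 2))).re < 0 →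
      haveI : LocallyCompactSpace (archLocal L 3 (Matrix.diagonal (α' ∘ ⇑τ)) w) := locallyCompactSpace_archLocal L 3 (Matrix.diagonal (α' ∘ ⇑τ)) w
      haveI : SecondCountableTopology (archLocal L 3 (Matrix.diagonal (α' ∘ ⇑τ)) w) := secondCountableTopology_archLocal L 3 (Matrix.diagonal (α' ∘ ⇑τ)) w
      haveI : (νH w τ).IsHaarMeasure := (hνH w τ).1
      haveI : (νH w τ).IsInvInvariant := (hνH w τ).2
      ∃ (ν : Measure (archLocal L 3 (Matrix.diagonal (α' ∘ ⇑τ)) w)) (_ : ν.IsHaarMeasure) (_ : ν.IsMulRightInvariant),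
      ∀ (Θ : Matrix (Fin 3) (Fin 3) ℂ → ℂ), ContDiff ℝ (⊤ : ℕ∞) Θ →
      HasCompactSupport (fun k : archLocal L 3 (Matrix.diagonal (α' ∘ ⇑τ)) w => Θ ((k : GL (Fin 3) ℂ) : Matrix (Fin 3) (Fin 3) ℂ)) →
      ∀ (z₀ : Fin 3 → Circle) (h02' : z₀ 0 = z₀ 2) (h01' : z₀ 0 ≠ z₀ 1),
      Tendsto (fun ψ : ℝ => deriv (fun ψ : ℝ => (2 * Real.sin ψ : ℂ) *
      ∫ g, Θ (((g * ⟨circleDiagonal 3 (fun i => z₀ i * Circle.exp (![(1 : ℝ), 0, -1] i * ψ)),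
      circleDiagonal_mem_archLocal_diagonal L 3 (α' ∘ ⇑τ) w _⟩ * g⁻¹ : archLocal L 3 (Matrix.diagonal (α' ∘ ⇑τ)) w) : GL (Fin 3) ℂ) : Matrix (Fin 3) (Fin 3) ℂ) ∂(ν)) ψ)
      (𝓝[≠] 0)
      (𝓝 ((-1 : ℂ) * ∫ y, descConj (⟨circleDiagonal 3 z₀, circleDiagonal_mem_archLocal_diagonal L 3 (α' ∘ ⇑τ) w z₀⟩ : archLocal L 3 (Matrix.diagonal (α' ∘ ⇑τ)) w)
      (Subgroup.centralizer ({(⟨circleDiagonal 3 (z₁ w), circleDiagonal_mem_archLocal_diagonal L 3 (α' ∘ ⇑τ) w (z₁ w)⟩ : archLocal L 3 (Matrix.diagonal (α' ∘ ⇑τ)) w)} : Set (archLocal L 3 (Matrix.diagonal (α' ∘ ⇑τ)) w)))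
      (forall_mem_centralizer_circleDiagonal_comm_of_wall L (α' ∘ ⇑τ) w (h02 w) (h01 w) h02' h01')
      (fun k : archLocal L 3 (Matrix.diagonal (α' ∘ ⇑τ)) w => Θ ((k : GL (Fin 3) ℂ) : Matrix (Fin 3) (Fin 3) ℂ)) y
      ∂(quotientMeasure _ (νH w τ) (isClosed_coe_centralizer_singleton _) (ν)))))
      (z : {w : InfinitePlace L // IsComplex w} → Fin 3 → Circle) (hwall : ∀ w, z w 0 = z w 2 ∧ z w 0 ≠ z w 1)
      (_hrat : ∃ a b : L, ∀ w : {w : InfinitePlace L // IsComplex w}, ((z w 0 : ℂ) = w.1.embedding a) ∧ ((z w 1 : ℂ) = w.1.embedding b))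
      (ρ : {w : InfinitePlace L // IsComplex w} → Perm (Fin 3))
      (ρZ : ∀ (w : {w : InfinitePlace L // IsComplex w}) (σ : Perm (Fin 3)), Measure (Subgroup.centralizer ({(⟨circleDiagonal 3 (z w ∘ ⇑σ), circleDiagonal_mem_archLocal_diagonal L 3 α' w (z w ∘ ⇑σ)⟩ : archLocal L 3 (Matrix.diagonal α') w)} : Set (archLocal L 3 (Matrix.diagonal α') w))))
      (_hρZi : ∀ w σ, (ρZ w σ).IsHaarMeasure ∧ (ρZ w σ).IsInvInvariant)
      (_hρZ : ∀ (w : {w : InfinitePlace L // IsComplex w}) (σ : Perm (Fin 3)), ¬ 0 < (w.1.embedding (α' (σ⁻¹ 0))).re * (w.1.embedding (α' (σ⁻¹ 2))).re →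
      ρZ w σ = (νH w σ⁻¹).map (subgroupCongrHomeomorph (ContinuousMulEquiv.restrictSubgroup (GLn.conjEquiv (Matrix.GeneralLinearGroup.mkOfDetNeZero _ (det_monomial_one_ne_zero 3 σ⁻¹))) (archLocal L 3 (Matrix.diagonal (α' ∘ ⇑σ⁻¹)) w) (archLocal L 3 (Matrix.diagonal α') w) (mem_archLocal_comp_perm_iff_conj_mem L 3 α' w σ⁻¹)).toMulEquiv
      (Subgroup.centralizer ({(⟨circleDiagonal 3 (z₁ w), circleDiagonal_mem_archLocal_diagonal L 3 (α' ∘ ⇑σ⁻¹) w (z₁ w)⟩ : archLocal L 3 (Matrix.diagonal (α' ∘ ⇑σ⁻¹)) w)} : Set (archLocal L 3 (Matrix.diagonal (α' ∘ ⇑σ⁻¹)) w)))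
      (Subgroup.centralizer ({(⟨circleDiagonal 3 (z w ∘ ⇑σ), circleDiagonal_mem_archLocal_diagonal L 3 α' w (z w ∘ ⇑σ)⟩ : archLocal L 3 (Matrix.diagonal α') w)} : Set (archLocal L 3 (Matrix.diagonal α') w)))
      (relabel_inv_mem_centralizer_circleDiagonal_comp_iff L α' w σ (h02 w) (h01 w) (hwall w).1 (hwall w).2)
      (ContinuousMulEquiv.restrictSubgroup (GLn.conjEquiv (Matrix.GeneralLinearGroup.mkOfDetNeZero _ (det_monomial_one_ne_zero 3 σ⁻¹))) (archLocal L 3 (Matrix.diagonal (α' ∘ ⇑σ⁻¹)) w) (archLocal L 3 (Matrix.diagonal α') w) (mem_archLocal_comp_perm_iff_conj_mem L 3 α' w σ⁻¹)).continuous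
      (ContinuousMulEquiv.restrictSubgroup (GLn.conjEquiv (Matrix.GeneralLinearGroup.mkOfDetNeZero _ (det_monomial_one_ne_zero 3 σ⁻¹))) (archLocal L 3 (Matrix.diagonal (α' ∘ ⇑σ⁻¹)) w) (archLocal L 3 (Matrix.diagonal α') w) (mem_archLocal_comp_perm_iff_conj_mem L 3 α' w σ⁻¹)).symm.continuous))
      (_hρZ1 : ∀ (w : {w : InfinitePlace L // IsComplex w}) (σ : Perm (Fin 3)), 0 < (w.1.embedding (α' (σ⁻¹ 0))).re * (w.1.embedding (α' (σ⁻¹ 2))).re → ρZ w σ Set.univ = 1)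
      (ρP : Measure (Subgroup.pi Set.univ (fun w : {w : InfinitePlace L // IsComplex w} => Subgroup.centralizer ({(⟨circleDiagonal 3 (z w ∘ ⇑(ρ w)), circleDiagonal_mem_archLocal_diagonal L 3 α' w (z w ∘ ⇑(ρ w))⟩ : archLocal L 3 (Matrix.diagonal α') w)} : Set (archLocal L 3 (Matrix.diagonal α') w)))))
      (_hρP : Measure.map (subgroupPiCoords fun w : {w : InfinitePlace L // IsComplex w} => Subgroup.centralizer ({(⟨circleDiagonal 3 (z w ∘ ⇑(ρ w)), circleDiagonal_mem_archLocal_diagonal L 3 α' w (z w ∘ ⇑(ρ w))⟩ : archLocal L 3 (Matrix.diagonal α') w)} : Set (archLocal L 3 (Matrix.diagonal α') w))) ρP = Measure.pi fun w => ρZ w (ρ w))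
      (ρ' : Measure (Subgroup.centralizer ({archDiagTorus L 3 α' (fun w => z w ∘ ⇑(ρ w))} : Set (arch (↥(maximalRealSubfield L)) L (IsCMField.complexConj L) 3 (Matrix.diagonal α')))))
      (_hρ' : ρ' = ρP.map (subgroupCongrHomeomorph (archPiEquivCM 3 L (Matrix.diagonal α')).symm.toMulEquiv (Subgroup.pi Set.univ (fun w : {w : InfinitePlace L // IsComplex w} => Subgroup.centralizer ({(⟨circleDiagonal 3 (z w ∘ ⇑(ρ w)), circleDiagonal_mem_archLocal_diagonal L 3 α' w (z w ∘ ⇑(ρ w))⟩ : archLocal L 3 (Matrix.diagonal α') w)} : Set (archLocal L 3 (Matrix.diagonal α') w)))) (Subgroup.centralizer ({archDiagTorus L 3 α' (fun w => z w ∘ ⇑(ρ w))} : Set (arch (↥(maximalRealSubfield L)) L (IsCMField.complexConj L) 3 (Matrix.diagonal α')))) (apply_mem_centralizer_iff_mem_pi_centralizer _ (archPiEquivCM 3 L (Matrix.diagonal α')).symm.toMulEquiv (archPiEquivCM_symm_circleDiagonal_eq_archDiagTorus L 3 α' (fun w => z w ∘ ⇑(ρ w)))) (archPiEquivCM 3 L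 (Matrix.diagonal α')).symm.continuous (archPiEquivCM 3 L (Matrix.diagonal α')).continuous)),
      centralizerTopFormHaar L (Matrix.diagonal α') (archDiagTorus L 3 α' (fun w => z w ∘ ⇑(ρ w))) = K • ρ' :=
  fun L _ _ _ => Summit.HodgeConjecture.HodgeConjecture.Cruxes.H413.F0P3ArchUniversalPinRatioOfWallCompatible.archSingularUniversalPinRatio_of_wallCompatible L (stub_WallCompat L)

/-! ### (R0-stmt) NAMED STATEMENTS for the kit junction (texts = the ED. 33 row texts token for token; R-2∕R-3) -/

/-- The text of the registered row `stub_N8` (archimedean inner-form transfer, ★ `ArchInnerTransferCompatible`), as a kit HYPOTHESIS type only. [cite: Rogawski1990, §14.2 (14.2.1) pp. 232–233] -/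
def N8Statement : Prop :=
  ∀ (L : Type) [Field L] [NumberField L] [IsCMField L] (H : Matrix (Fin 3) (Fin 3) L)
    [MeasurableSpace (GpInf L H)] [BorelSpace (GpInf L H)] [MeasurableSpace (GInf L)] [BorelSpace (GInf L)]
    [MeasurableSpace (HInf L)] [BorelSpace (HInf L)]
    (ν' : Measure (GpInf L H)) (ν : Measure (GInf L))
    [ν'.IsHaarMeasure] [ν'.IsMulRightInvariant] [ν.IsHaarMeasure] [ν.IsMulRightInvariant],
    ArchInnerTransferCompatible L H ν' ν

/-- The text of the registered row `stub_N9` (archimedean endoscopic transfer at `Δ″_∞`), as a kit HYPOTHESIS type only. [cite: Rogawski1990, §14.3 pp. 233–234] -/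
def N9Statement : Prop :=
  ∀ (L : Type) [Field L] [NumberField L] [IsCMField L] (H : Matrix (Fin 3) (Fin 3) L)
    [MeasurableSpace (GpInf L H)] [BorelSpace (GpInf L H)] [MeasurableSpace (GInf L)] [BorelSpace (GInf L)]
    [MeasurableSpace (HInf L)] [BorelSpace (HInf L)]
    (ν' : Measure (GpInf L H)) (ν : Measure (GInf L)) (νH : Measure (HInf L))
    [ν'.IsHaarMeasure] [ν'.IsMulRightInvariant] [ν.IsHaarMeasure] [ν.IsMulRightInvariant] [νH.IsHaarMeasure] [νH.IsMulRightInvariant]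
    (μ : HeckeCharacter L) (_hμu : μ.IsUnitary)
    (_hμω : ∀ x : Literature.NumberTheory.GaloisRepresentations.ideleGroup ↥(maximalRealSubfield L), μ (AdeleRing.ideleBaseChange (↥(maximalRealSubfield L)) L x) = quadraticHeckeCharCM L x)
    (hl : ∀ (a : HInf L) (b : GpInf L H) (x : HInf L), archExplicitDelta L H (x * a * x⁻¹) μ b = archExplicitDelta L H a μ b)
    (hr : ∀ (a : HInf L) (b y : GpInf L H), archExplicitDelta L H a μ (y * b * y⁻¹) = archExplicitDelta L H a μ b),
    ArchEndoscopicTransferCompatible L H (archExplicitTransferFactor L H μ hl hr) ν' ν νH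

/-- The text of the DERIVED row `stub_QCMTS` (signed CM character identities on test functions), as a kit HYPOTHESIS type. [cite: Rogawski1990, §12.7 Lemma 12.7.3 p. 195; §13.1 Prop. 13.1.4 p. 199] -/
def QCMTSStatement : Prop :=
  ∀ (L : Type) [Field L] [NumberField L] [IsCMField L] (H : Matrix (Fin 3) (Fin 3) L) (μ : HeckeCharacter L)
    [∀ v : Places L, MeasurableSpace (HLocal L v)] [∀ v : Places L, BorelSpace (HLocal L v)]
    [∀ v : Places L, MeasurableSpace (GpLocal L H v)] [∀ v : Places L, BorelSpace (GpLocal L H v)]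
    (νH : ∀ v : Places L, Measure (HLocal L v)) (νG : ∀ v : Places L, Measure (GpLocal L H v))
    [∀ v, (νH v).IsHaarMeasure] [∀ v, (νH v).IsMulRightInvariant] [∀ v, (νG v).IsHaarMeasure] [∀ v, (νG v).IsMulRightInvariant]
    (hμu : μ.IsUnitary)
    (_hμω : ∀ x : Literature.NumberTheory.GaloisRepresentations.ideleGroup ↥(maximalRealSubfield L), μ (AdeleRing.ideleBaseChange (↥(maximalRealSubfield L)) L x) = quadraticHeckeCharCM L x)
    (hherm : (H.map (cmConjRingHom L))ᵀ = H) (hanis : ∀ x : Fin 3 → L, Literature.AlgebraicGeometry.ShimuraVarieties.hermForm (cmConjRingHom L) H x x = 0 → x = 0),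
    letI : ∀ (v : Places L) (a : HLocal L v), MeasurableSpace (HLocal L v ⧸ Subgroup.centralizer ({a} : Set (HLocal L v))) := fun _ _ => borel _
    haveI : ∀ (v : Places L) (a : HLocal L v), BorelSpace (HLocal L v ⧸ Subgroup.centralizer ({a} : Set (HLocal L v))) := fun _ _ => ⟨rfl⟩
    letI : ∀ (v : Places L) (γ : GpLocal L H v), MeasurableSpace (GpLocal L H v ⧸ Subgroup.centralizer ({γ} : Set (GpLocal L H v))) := fun _ _ => borel _
    haveI : ∀ (v : Places L) (γ : GpLocal L H v), BorelSpace (GpLocal L H v ⧸ Subgroup.centralizer ({γ} : Set (GpLocal L H v))) := fun _ _ => ⟨rfl⟩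
    ∀ (mH : ∀ v : Places L, OrbitalMeasureFamily (HLocal L v)) (mG : ∀ v : Places L, OrbitalMeasureFamily (GpLocal L H v)),
      (∀ v : Places L, (mH v).IsCanonical (IsLocalGRegular L v) (νH v) ∧
          (mG v).IsCanonical (fun γ => IsRegularElt (γ.val : GL (Fin 3) (UnitaryGroup.LocalRing L v))) (νG v)) →
        CMCharIdentityPackageTestSigned L H hherm (isUnit_iff_ne_zero.mpr (Godement.det_ne_zero_of_anisotropic L H hanis)) νH νG μ hμu
          (finExplicitCollection L H μ (finExplicitDelta_conj_left_all L H μ) (finExplicitDelta_conj_right_all L H μ)) mH mG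

/-- The text of the DERIVED row `stub_K9STFSv` («K9STFS-v TYPE»: `stub_K9STFS`՚s ED. 26–32 text + binders 33∕34), named for the aggregator՚s one-liner. [cite: Rogawski1990, §14.6 (14.6.1) pp. 240–241] ED. 5 (closer ED. 38 «PK-ε»): + the root-number witness `wXi` and its law in the ∃ [Rogawski1992 Thm. 1.2].
ED. 8 («F11 ⊕ F12»): + `(hdef …) (h2 …)` after `hT`, `(hμω …)` after `hμu` (= AGG ED. 46 `stub_K9STFSv` ∕ (T-B) ED. 5 conclusion).  [cite: Rogawski1990, §14.5 p. 239; §12.1 p. 171] -/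
def K9STFSvStatement : Prop :=
  ∀ (L : Type) [Field L] [NumberField L] [IsCMField L] (ι : L →+* ℂ) (H : Matrix (Fin 3) (Fin 3) L) (T : GL (Fin 3) ℂ)
  (hT : (T : Matrix (Fin 3) (Fin 3) ℂ)ᴴ * H.map ι * (T : Matrix (Fin 3) (Fin 3) ℂ) = Literature.Geometry.ComplexHyperbolic.BallModel.J)
  (hdef : ∀ τ' : L →+* ℂ, InfinitePlace.mk τ' ≠ InfinitePlace.mk ι → (H.map τ').PosDef) (h2 : 2 ≤ Module.finrank ℚ ↥(maximalRealSubfield L))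
  (μ : Measure (Gp L H).automorphicQuotient) [(Gp L H).IsAutomorphicMeasure μ] (μω : HeckeCharacter L) (hμu : μω.IsUnitary)
  (hμω : ∀ x : Literature.NumberTheory.GaloisRepresentations.ideleGroup ↥(maximalRealSubfield L), μω (AdeleRing.ideleBaseChange (↥(maximalRealSubfield L)) L x) = quadraticHeckeCharCM L x)
  (ν : @Measure (GpAdelic L H) (borel _))
  (νH : ∀ v : Places L, @Measure (HLocal L v) (borel _)) (νG : ∀ v : Places L, @Measure (GpLocal L H v) (borel _))
  (νGi : @Measure (GpInf L H) (borel _)) (νqi : @Measure (GInf L) (borel _)) (νHi : @Measure (HInf L) (borel _))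
  (μZ : ∀ v : Places L, @Measure (Gqs L v ⧸ Subgroup.center (Gqs L v)) (borel _))
  (isHaar_ν : letI : MeasurableSpace (GpAdelic L H) := borel _; ν.IsHaarMeasure)
  (isInvInv_ν : letI : MeasurableSpace (GpAdelic L H) := borel _; ν.IsInvInvariant)
  (isHaar_νH : ∀ v : Places L, letI : MeasurableSpace (HLocal L v) := borel _; (νH v).IsHaarMeasure)
  (isRightInv_νH : ∀ v : Places L, letI : MeasurableSpace (HLocal L v) := borel _; (νH v).IsMulRightInvariant)
  (isHaar_νG : ∀ v : Places L, letI : MeasurableSpace (GpLocal L H v) := borel _; (νG v).IsHaarMeasure)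
  (isRightInv_νG : ∀ v : Places L, letI : MeasurableSpace (GpLocal L H v) := borel _; (νG v).IsMulRightInvariant)
  (finCpt_νGi : letI : MeasurableSpace (GpInf L H) := borel _; IsFiniteMeasureOnCompacts νGi)
  (rightInv_νGi : letI : MeasurableSpace (GpInf L H) := borel _; νGi.IsMulRightInvariant)
  (finCpt_νqi : letI : MeasurableSpace (GInf L) := borel _; IsFiniteMeasureOnCompacts νqi)
  (rightInv_νqi : letI : MeasurableSpace (GInf L) := borel _; νqi.IsMulRightInvariant)
  (finCpt_νHi : letI : MeasurableSpace (HInf L) := borel _; IsFiniteMeasureOnCompacts νHi)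
  (rightInv_νHi : letI : MeasurableSpace (HInf L) := borel _; νHi.IsMulRightInvariant)
  (isHaar_μZ : ∀ v : Places L, letI : MeasurableSpace (Gqs L v ⧸ Subgroup.center (Gqs L v)) := borel _; (μZ v).IsHaarMeasure)
  (hquad : ∀ v : Places L, (∀ w : PlacesOver L v, IsCMField.complexConj L • w.1 = w.1) →
    IsQuadraticCharExtension (conjLocal L (IsCMField.complexConj L) v) (μω.semilocalComponent L v))
  -- binders 33∕34 (ED. «K9STF ⟸ TUPLE», desk D35 (11)–(13), BOARD rev. 7 R7-0.8 ∕ rev. 8): `vol_{νG_v}(K′_v) = 1` = `Rung0WitnessS.hK`, `vol_{νH_v}(K_{2,v} × K_{1,v}) = 1` = `Rung0WitnessS.hKH`, VERBATIM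
  (hvol : ∀ v : Places L, νG v (cmLocalIntegralLevel L 3 H v : Set (GpLocal L H v)) = 1)
  (hvolH : ∀ v : Places L,
    νH v (((cmLocalIntegralLevel L 2 (Matrix.of fun i j : Fin 2 => if i.val + j.val + 1 = 2 then (1 : L) else 0) v).prod
        (cmLocalIntegralLevel L 1 (Matrix.of fun i j : Fin 1 => if i.val + j.val + 1 = 1 then (1 : L) else 0) v) :
          Subgroup (HLocal L v)) : Set (HLocal L v)) = 1),
    -- (K9-∃) THE LETTER DELIVERS the global sign, the per-ξ ROOT NUMBERS `wXi ξ = ε(½, φ_ξ) = ±1` (ED. 5 [Rogawski1992 Thm. 1.2]) and the archimedean classes WITH their R3∕R4 clauses (print: `c = ε`, `jInf∕dsInf = [J_φ^{±}]∕[D_φ]`,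
    -- [Rogawski1990 §12.3 pp. 178–179; Prop. 15.2.1]; R3∕R4 for them: [BorelWallach2000 I §5.3 (Wigner), II §5.4, VI Thm. 4.11]) — NOT ∀-quantified over them
    ∃ (c : ℚ) (wXi : OneDimAutRepH L → ℤ) (jInf dsInf : ℤ → ℤ → ℤ → Cinf), (c = 1 ∨ c = -1) ∧ (∀ ξ, wXi ξ = 1 ∨ wXi ξ = -1) ∧ JInfNoDegOne jInf ∧ DsInfNoDegOne dsInf ∧
      (∀ p q t : ℤ, IsCohUnitaryClass (jInf p q t)) ∧ (∀ p q t : ℤ, IsCohUnitaryClass (dsInf p q t)) ∧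
    K9SpectralLetterSigned L ι H T hT μ μω hμu ν νH νG νGi νqi νHi μZ isHaar_ν isInvInv_ν isHaar_νH isRightInv_νH isHaar_νG isRightInv_νG finCpt_νGi rightInv_νGi finCpt_νqi rightInv_νqi finCpt_νHi rightInv_νHi isHaar_μZ hquad c wXi jInf dsInf

/-- The text of the DERIVED row `stub_K9v` («K9-∃-v»: T1՚s antecedents-form with `hc hJ hD hJU hDU` in the ∃), as a kit HYPOTHESIS∕conclusion type. [cite: Rogawski1990, §14.6 Thm. 14.6.1 p. 241] ED. 5 (closer ED. 38 «PK-ε»): + the root-number witness `wXi` and its law in the ∃ [Rogawski1992 Thm. 1.2].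
ED. 8 («F11 ⊕ F12»): + `(hdef …) (h2 …)` after `hT`, `(hμω …)` after `hμu` (= AGG ED. 46 `stub_K9v` ∕ (T-A) ED. 5 `k9_of_stfSv`՚s conclusion); applied at :368 with `hdef h2`∕`hμω` from :348.  [cite: Rogawski1990, §14.5 p. 239; §12.1 p. 171] -/
def K9vStatement : Prop :=
  ∀ (L : Type) [Field L] [NumberField L] [IsCMField L] (ι : L →+* ℂ) (H : Matrix (Fin 3) (Fin 3) L) (T : GL (Fin 3) ℂ)
  (hT : (T : Matrix (Fin 3) (Fin 3) ℂ)ᴴ * H.map ι * (T : Matrix (Fin 3) (Fin 3) ℂ) = Literature.Geometry.ComplexHyperbolic.BallModel.J)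
  (hdef : ∀ τ' : L →+* ℂ, InfinitePlace.mk τ' ≠ InfinitePlace.mk ι → (H.map τ').PosDef) (h2 : 2 ≤ Module.finrank ℚ ↥(maximalRealSubfield L))
  (μ : Measure (Gp L H).automorphicQuotient) [(Gp L H).IsAutomorphicMeasure μ] (μω : HeckeCharacter L) (hμu : μω.IsUnitary)
  (hμω : ∀ x : Literature.NumberTheory.GaloisRepresentations.ideleGroup ↥(maximalRealSubfield L), μω (AdeleRing.ideleBaseChange (↥(maximalRealSubfield L)) L x) = quadraticHeckeCharCM L x)
  (ν : @Measure (GpAdelic L H) (borel _))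
  (νH : ∀ v : Places L, @Measure (HLocal L v) (borel _)) (νG : ∀ v : Places L, @Measure (GpLocal L H v) (borel _))
  (νGi : @Measure (GpInf L H) (borel _)) (νqi : @Measure (GInf L) (borel _)) (νHi : @Measure (HInf L) (borel _))
  (μZ : ∀ v : Places L, @Measure (Gqs L v ⧸ Subgroup.center (Gqs L v)) (borel _))
  (isHaar_ν : letI : MeasurableSpace (GpAdelic L H) := borel _; ν.IsHaarMeasure)
  (isInvInv_ν : letI : MeasurableSpace (GpAdelic L H) := borel _; ν.IsInvInvariant)
  (isHaar_νH : ∀ v : Places L, letI : MeasurableSpace (HLocal L v) := borel _; (νH v).IsHaarMeasure)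
  (isRightInv_νH : ∀ v : Places L, letI : MeasurableSpace (HLocal L v) := borel _; (νH v).IsMulRightInvariant)
  (isHaar_νG : ∀ v : Places L, letI : MeasurableSpace (GpLocal L H v) := borel _; (νG v).IsHaarMeasure)
  (isRightInv_νG : ∀ v : Places L, letI : MeasurableSpace (GpLocal L H v) := borel _; (νG v).IsMulRightInvariant)
  (finCpt_νGi : letI : MeasurableSpace (GpInf L H) := borel _; IsFiniteMeasureOnCompacts νGi)
  (rightInv_νGi : letI : MeasurableSpace (GpInf L H) := borel _; νGi.IsMulRightInvariant)
  (finCpt_νqi : letI : MeasurableSpace (GInf L) := borel _; IsFiniteMeasureOnCompacts νqi)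
  (rightInv_νqi : letI : MeasurableSpace (GInf L) := borel _; νqi.IsMulRightInvariant)
  (finCpt_νHi : letI : MeasurableSpace (HInf L) := borel _; IsFiniteMeasureOnCompacts νHi)
  (rightInv_νHi : letI : MeasurableSpace (HInf L) := borel _; νHi.IsMulRightInvariant)
  (isHaar_μZ : ∀ v : Places L, letI : MeasurableSpace (Gqs L v ⧸ Subgroup.center (Gqs L v)) := borel _; (μZ v).IsHaarMeasure)
  (hquad : ∀ v : Places L, (∀ w : PlacesOver L v, IsCMField.complexConj L • w.1 = w.1) →
    IsQuadraticCharExtension (conjLocal L (IsCMField.complexConj L) v) (μω.semilocalComponent L v))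
  -- binders 33∕34 (ED. «K9STF ⟸ TUPLE», desk D35 (11)–(13), BOARD rev. 7 R7-0.8 ∕ rev. 8): `vol_{νG_v}(K′_v) = 1` = `Rung0WitnessS.hK`, `vol_{νH_v}(K_{2,v} × K_{1,v}) = 1` = `Rung0WitnessS.hKH`, VERBATIM
  (hvol : ∀ v : Places L, νG v (cmLocalIntegralLevel L 3 H v : Set (GpLocal L H v)) = 1)
  (hvolH : ∀ v : Places L,
    νH v (((cmLocalIntegralLevel L 2 (Matrix.of fun i j : Fin 2 => if i.val + j.val + 1 = 2 then (1 : L) else 0) v).prod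
        (cmLocalIntegralLevel L 1 (Matrix.of fun i j : Fin 1 => if i.val + j.val + 1 = 1 then (1 : L) else 0) v) :
          Subgroup (HLocal L v)) : Set (HLocal L v)) = 1),
    -- (K9-∃) THE LETTER DELIVERS the global sign, the per-ξ ROOT NUMBERS `wXi ξ = ε(½, φ_ξ) = ±1` (ED. 5 [Rogawski1992 Thm. 1.2]) and the archimedean classes WITH their R3∕R4 clauses (print: `c = ε`, `jInf∕dsInf = [J_φ^{±}]∕[D_φ]`,
    -- [Rogawski1990 §12.3 pp. 178–179; Prop. 15.2.1]; R3∕R4 for them: [BorelWallach2000 I §5.3 (Wigner), II §5.4, VI Thm. 4.11]) — NOT ∀-quantified over them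
    ∃ (c : ℚ) (wXi : OneDimAutRepH L → ℤ) (jInf dsInf : ℤ → ℤ → ℤ → Cinf), (c = 1 ∨ c = -1) ∧ (∀ ξ, wXi ξ = 1 ∨ wXi ξ = -1) ∧ JInfNoDegOne jInf ∧ DsInfNoDegOne dsInf ∧
      (∀ p q t : ℤ, IsCohUnitaryClass (jInf p q t)) ∧ (∀ p q t : ℤ, IsCohUnitaryClass (dsInf p q t)) ∧
    letI : ∀ (v : Places L) (a : HLocal L v), MeasurableSpace (HLocal L v ⧸ Subgroup.centralizer ({a} : Set (HLocal L v))) := fun _ _ => borel _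
    letI : ∀ (v : Places L) (γ : (cmDatum L 3 H).Local v),
        MeasurableSpace ((cmDatum L 3 H).Local v ⧸ Subgroup.centralizer ({γ} : Set ((cmDatum L 3 H).Local v))) := fun _ _ => borel _
    haveI : ∀ (v : Places L) (a : HLocal L v), BorelSpace (HLocal L v ⧸ Subgroup.centralizer ({a} : Set (HLocal L v))) := fun _ _ => ⟨rfl⟩
    haveI : ∀ (v : Places L) (γ : (cmDatum L 3 H).Local v),
        BorelSpace ((cmDatum L 3 H).Local v ⧸ Subgroup.centralizer ({γ} : Set ((cmDatum L 3 H).Local v))) := fun _ _ => ⟨rfl⟩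
    ∀ (mH : ∀ v : Places L, OrbitalMeasureFamily (HLocal L v)) (mG : ∀ v : Places L, OrbitalMeasureFamily ((cmDatum L 3 H).Local v)),
      letI : MeasurableSpace (GpAdelic L H) := borel _
      haveI : BorelSpace (GpAdelic L H) := ⟨rfl⟩
      haveI : ν.IsHaarMeasure := isHaar_ν
      haveI : ν.IsInvInvariant := isInvInv_ν
      letI : ∀ v : Places L, MeasurableSpace (GpLocal L H v) := fun _ => borel _
      haveI : ∀ v : Places L, BorelSpace (GpLocal L H v) := fun _ => ⟨rfl⟩
      letI : ∀ v : Places L, MeasurableSpace (HLocal L v) := fun _ => borel _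
      haveI : ∀ v : Places L, BorelSpace (HLocal L v) := fun _ => ⟨rfl⟩
      letI : ∀ (v : Places L) (a : HLocal L v), MeasurableSpace (HLocal L v ⧸ Subgroup.centralizer ({a} : Set (HLocal L v))) := fun _ _ => borel _
      letI : ∀ (v : Places L) (γ : GpLocal L H v), MeasurableSpace (GpLocal L H v ⧸ Subgroup.centralizer ({γ} : Set (GpLocal L H v))) := fun _ _ => borel _
      letI : MeasurableSpace (GpInf L H) := borel _
      haveI : BorelSpace (GpInf L H) := ⟨rfl⟩
      letI : MeasurableSpace (GInf L) := borel _
      haveI : BorelSpace (GInf L) := ⟨rfl⟩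
      letI : MeasurableSpace (HInf L) := borel _
      haveI : BorelSpace (HInf L) := ⟨rfl⟩
      haveI : ∀ v : Places L, (νH v).IsHaarMeasure := isHaar_νH
      haveI : ∀ v : Places L, (νH v).IsMulRightInvariant := isRightInv_νH
      haveI : ∀ v : Places L, (νG v).IsHaarMeasure := isHaar_νG
      haveI : ∀ v : Places L, (νG v).IsMulRightInvariant := isRightInv_νG
      haveI : IsFiniteMeasureOnCompacts νGi := finCpt_νGi
      haveI : νGi.IsMulRightInvariant := rightInv_νGi
      haveI : IsFiniteMeasureOnCompacts νqi := finCpt_νqi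
      haveI : νqi.IsMulRightInvariant := rightInv_νqi
      haveI : IsFiniteMeasureOnCompacts νHi := finCpt_νHi
      haveI : νHi.IsMulRightInvariant := rightInv_νHi
      (∀ v : Places L, (mH v).IsCanonical (IsLocalGRegular L v) (νH v) ∧
          (mG v).IsCanonical (fun γ => IsRegularElt (γ.val : GL (Fin 3) (UnitaryGroup.LocalRing L v))) (νG v)) →
      ∀ (𝔨 : ComparisonKit L H μ), 𝔨.IsPinned ν (archCanonicalTransferFactor L H μω) νH νG νGi νqi νHi → 𝔨.TransferExistence → 𝔨.SimpleTraceFormula → 𝔨.Δ = (finExplicitCollection L H μω (finExplicitDelta_conj_left_all L H μω) (finExplicitDelta_conj_right_all L H μω)) → 𝔨.mH = mH →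
        (∀ (v : Places L) (c' : ConjClasses ((cmDatum L 3 H).Local v)),
          Literature.NumberTheory.Rogawski1990.IsRegularElt ((Quotient.out c').val : GL (Fin 3) (UnitaryGroup.LocalRing L v)) → 𝔨.mG v c' = mG v c') →
        ∀ (hQ : CMCharIdentityPackageTestSigned L H (transpose_map_cmConjRingHom_eq_of_frame L ι H T hT) (isUnit_det_of_frame L ι H T hT) νH νG μω hμu (finExplicitCollection L H μω (finExplicitDelta_conj_left_all L H μω) (finExplicitDelta_conj_right_all L H μω)) mH mG)
          (hK : KeysCaseTwo L) (hLi : XiPinSphericalCofinite L),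
          Nonempty (OverrideWitnessS L ι H T hT μ μω hμu ν νH νG νGi μZ c wXi jInf dsInf isHaar_ν isHaar_μZ hquad (finExplicitCollection L H μω (finExplicitDelta_conj_left_all L H μω) (finExplicitDelta_conj_right_all L H μω)) mH mG hQ hK hLi 𝔨)

/-- **THE RUNG-0 STATEMENT, PINNED** (KitRung0 ED. 6 «PINS STATED» — closer ED. 41 «Δ‴-PINS EXPOSED», LEAD F0P3a-plan (g13) T12-35∕T12-36∕T12-37, desk F0P3-plan (g14)
D69‴∕D69⁗; LHref-S (g2) BOX LH10 #3 (G1)): `StubRung0S` (★ Defs: `∀ frame, Nonempty (Rung0WitnessS …)`) delivers the rung-0 witness `W` whose `hGTQ` is the global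
transfer ∕ stabilisation package with the rider `Q_K9S` — an `∃ (S_bad, Δ, m_H, m_G)` that FORGETS that the finite transfer factor the letters actually build is print՚s
`Δ‴ = τ·D_{G∕H}·κ` (★ `finExplicitCollection`).  THIS sibling delivers the same `W` AND the package once more at the PINNED rider
«`fun Δ mH mG => Δ = finExplicitCollection L H μω (…) (…) ∧ Q_K9S ‹W՚s measures, factor, sign, root numbers, arch classes› Δ mH mG`» (same Haar ∕ Borel preamble as
`Rung0WitnessS.hGTQ`), so that the T1 export (★ `anchoredKit_nonempty_of_stubsQ_loc`, T1-API ed. 1.25) hands the closer՚s `Rung0ChoicePinned` (KitD ED. 6) the pin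
`hΔ : 𝔨.Δ = Δ‴` next to `hloc₀ ∕ hcan₀` — the three facts the LH10 «(D-b)ᵀ» Day-X junction reads.  `Q_K9S`, `Rung0WitnessS`, `StubRung0S` (Defs) are untouched.
[cite: Rogawski1990, §4.9 Prop. 4.9.1 p. 55; §4.3 (4.3.1)–(4.3.3) pp. 43–44; §14.6 Thm. 14.6.1 p. 241; §13.1 Prop. 13.1.4 p. 199] [cite: LanglandsShelstad1987, §1.3–1.4] -/
def StubRung0SPinned : Prop :=
  ∀ (L : Type) [Field L] [NumberField L] [IsCMField L] (ι : L →+* ℂ) (H : Matrix (Fin 3) (Fin 3) L) (T : GL (Fin 3) ℂ)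
    (hT : (T : Matrix (Fin 3) (Fin 3) ℂ)ᴴ * H.map ι * (T : Matrix (Fin 3) (Fin 3) ℂ) = Literature.Geometry.ComplexHyperbolic.BallModel.J),
    (∀ τ' : L →+* ℂ, InfinitePlace.mk τ' ≠ InfinitePlace.mk ι → (H.map τ').PosDef) →
    2 ≤ Module.finrank ℚ ↥(maximalRealSubfield L) →
    ∀ (μ : Measure (Gp L H).automorphicQuotient) [(Gp L H).IsAutomorphicMeasure μ] (μω : HeckeCharacter L) (hμu : μω.IsUnitary)
      (hμω : ∀ x : Literature.NumberTheory.GaloisRepresentations.ideleGroup ↥(maximalRealSubfield L),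
        μω (AdeleRing.ideleBaseChange (↥(maximalRealSubfield L)) L x) = quadraticHeckeCharCM L x),
      ∃ W : Rung0WitnessS L ι H T hT μ μω hμu hμω,
        letI : ∀ v : Places L, MeasurableSpace (GpLocal L H v) := fun _ => borel _
        haveI : ∀ v : Places L, BorelSpace (GpLocal L H v) := fun _ => ⟨rfl⟩
        letI : ∀ v : Places L, MeasurableSpace (HLocal L v) := fun _ => borel _
        haveI : ∀ v : Places L, BorelSpace (HLocal L v) := fun _ => ⟨rfl⟩
        haveI : ∀ v : Places L, (W.νH v).IsHaarMeasure := W.isHaar_νH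
        haveI : ∀ v : Places L, (W.νH v).IsMulRightInvariant := W.isRightInv_νH
        haveI : ∀ v : Places L, (W.νG v).IsHaarMeasure := W.isHaar_νG
        haveI : ∀ v : Places L, (W.νG v).IsMulRightInvariant := W.isRightInv_νG
        GlobalTransferWithStabilisationPackageAnd L H W.Tinf.Δ W.νH W.νG
          (fun Δ mH mG => Δ = finExplicitCollection L H μω (finExplicitDelta_conj_left_all L H μω) (finExplicitDelta_conj_right_all L H μω) ∧
            Q_K9S L ι H T hT μ μω hμu W.ν W.νH W.νG W.νGi W.νqi W.νHi W.μZ W.Tinf W.c W.wXi W.jInf W.dsInf W.isHaar_ν W.isInvInv_ν W.isHaar_νH W.isRightInv_νH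
              W.isHaar_νG W.isRightInv_νG W.finCpt_νGi W.rightInv_νGi W.finCpt_νqi W.rightInv_νqi W.finCpt_νHi W.rightInv_νHi W.isHaar_μZ
              (fun v _ => isQuadraticCharExtension_semilocalComponent_of_baseChange_eq μω hμω v) Δ mH mG)

namespace Kit

/-- **THE RUNG-0 JUNCTION, PINNED** (KitRung0 ED. 6 «PINS STATED» — closer ED. 41 «Δ‴-PINS EXPOSED», LEAD F0P3a-plan (g13) T12-35∕T12-37, desk F0P3-plan (g14) D69‴∕D69⁗):
the body of `rung0_of_letters` VERBATIM, delivering the SAME witness `W` together with the package at the PINNED rider «`Δ = Δ‴ ∧ Q_K9S …`» (`StubRung0SPinned`): ★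
`rung0Data_of_letters_normalised`՚s `hG` clause is GENERIC in the rider and applies it at print՚s `Δ‴ = finExplicitCollection …` LITERALLY, so the pin is `rfl` in the
callback; the two `Q_K9S` conjuncts are proved exactly as in `rung0_of_letters` (`hQ`, `hK9`).  The aggregator՚s `rung0Choice` switches to this producer at ED. 41 L3;
`rung0_of_letters` above stays byte-identical.  SORRY-FREE; axioms TRIO.
ED. 7 «#175 PINNED»: `hS1n : TamagawaSingularMembersExistNormalisedClosedPinned` (S1′ AT print՚s `(Δ‴_∞, Δ‴)`; ★ registrar L2) and the data from ★ T1 twin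
`F0P3Rung0OfLettersNormalisedPinned.rung0Data_of_letters_normalisedPinned` — its `hSET` conjunct is `SingularEllipticTransferCanonicalPinned L H μω …`, δ-equal to the Defs ED. 4 field at
`Tinf := archCanonicalTransferFactor L H μω`; `rung0_of_letters` (unpinned) DROPPED.  Body otherwise byte-identical to ED. 6.
[cite: Rogawski1990, §4.9 Prop. 4.9.1 p. 55; §4.3 (4.3.1)–(4.3.3) pp. 43–44; §14.6 Thm. 14.6.1 p. 241; §13.1 p. 199] [cite: LanglandsShelstad1987, §1.3–1.4] -/
theorem rung0_of_letters_pinned (hN8 : N8Statement) (hN9 : N9Statement) (hSd : ArchCentralValueTransferExistsClosed) (hN6 : LocalTransferExplicitClosed)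
    (hS1n : TamagawaSingularMembersExistNormalisedClosedPinned) (hQ : QCMTSStatement) (hK9v : K9vStatement) : StubRung0SPinned := by
  intro L _ _ _ ι H T hT hdef h2 μ _ μω hμu hμω
  have hherm : (H.map (cmConjRingHom L)).transpose = H := transpose_map_cmConjRingHom_eq_of_frame L ι H T hT
  have hanis := F0P3ClassTokensOfRecord.anisotropic_of_frame L H ι hdef h2
  letI : MeasurableSpace (GpInf L H) := borel _
  haveI : BorelSpace (GpInf L H) := ⟨rfl⟩
  letI : MeasurableSpace (GInf L) := borel _
  haveI : BorelSpace (GInf L) := ⟨rfl⟩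
  letI : MeasurableSpace (HInf L) := borel _
  haveI : BorelSpace (HInf L) := ⟨rfl⟩
  letI : ∀ v : Places L, MeasurableSpace (GpLocal L H v) := fun _ => borel _
  haveI : ∀ v : Places L, BorelSpace (GpLocal L H v) := fun _ => ⟨rfl⟩
  letI : ∀ v : Places L, MeasurableSpace (HLocal L v) := fun _ => borel _
  haveI : ∀ v : Places L, BorelSpace (HLocal L v) := fun _ => ⟨rfl⟩
  obtain ⟨ν, νH, νG, νGi, νqi, νHi, μZ, hν, hνi, hνH, hνHr, hνG, hνGr, hK, hKH, hνGic, hνGir, hνqic, hνqir, hνHic, hνHir, hμZ,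
      hAT, hSET, hG, hPH⟩ :=
    F0P3Rung0OfLettersNormalisedPinned.rung0Data_of_letters_normalisedPinned L ι H T hT hdef h2 μω hμu hμω
      (fun ν' ν _ _ _ _ => hN8 L H ν' ν)
      (fun ν' ν νH _ _ _ _ _ _ => hN9 L H ν' ν νH μω hμu hμω (archExplicitDelta_conj_left L H μω) (archExplicitDelta_conj_right L H μω))
      stub_Sc hSd hN6 stub_N7 hS1n
  obtain ⟨c, wXi, jInf, dsInf, hc, hw, hJ, hD, hJU, hDU, hK9⟩ :=
    hK9v L ι H T hT hdef h2 μ μω hμu hμω ν νH νG νGi νqi νHi μZ hν hνi hνH hνHr hνG hνGr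
      hνGic hνGir hνqic hνqir hνHic hνHir hμZ (fun v _ => isQuadraticCharExtension_semilocalComponent_of_baseChange_eq μω hμω v) hK hKH
  exact ⟨{ ν := ν, νH := νH, νG := νG, νGi := νGi, νqi := νqi, νHi := νHi, μZ := μZ,
            Tinf := archCanonicalTransferFactor L H μω, c := c, wXi := wXi, jInf := jInf, dsInf := dsInf,
            isHaar_ν := hν, isInvInv_ν := hνi, isHaar_νH := hνH, isRightInv_νH := hνHr, isHaar_νG := hνG, isRightInv_νG := hνGr,
            hK := hK, hKH := hKH, finCpt_νGi := hνGic, rightInv_νGi := hνGir, finCpt_νqi := hνqic, rightInv_νqi := hνqir,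
            finCpt_νHi := hνHic, rightInv_νHi := hνHir, isHaar_μZ := hμZ,
            hAT₄ := hAT, hSET := hSET,
            hGTQ := hG (Q_K9S L ι H T hT μ μω hμu ν νH νG νGi νqi νHi μZ (archCanonicalTransferFactor L H μω) c wXi jInf dsInf hν hνi hνH hνHr hνG hνGr
                hνGic hνGir hνqic hνqir hνHic hνHir hμZ (fun v _ => isQuadraticCharExtension_semilocalComponent_of_baseChange_eq μω hμω v))
              (fun mH mG h => And.intro (hQ L H μω νH νG hμu hμω hherm hanis mH mG h) (hK9 mH mG h)),
            hw := hw, hc := hc, hJ := hJ, hD := hD, hJU := hJU, hDU := hDU, hPH := hPH },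
    hG _ (fun mH mG h => ⟨rfl, hQ L H μω νH νG hμu hμω hherm hanis mH mG h, hK9 mH mG h⟩)⟩

/-- **(ED. 35 «L21 ⟸ A6-lim», LEAD F0P3a-plan (g12) WORDS T10-50∕T11-3∕T11-7; kit term, SORRY-FREE)** — the (L_{U(2,1)}) letter `ArchCentralLimitFormulaRankTwo` at every frame from
the LITERAL print row (A6-lim) `ArchCentralLimitExists` («the central limit of `ω(ρ′Δ Φ_Θ)` exists», Rogawski p. 126 L13 = [H₂] L. 17.5, continuity half) and the IN-HOUSE W6-core value
★ `ballCore_of_rayIdentity rayIdentity_of_total` (p845507 ∘ p846302 over ★ p845494∕p846272∕…), via ★ p846458 `archCentralLimitFormulaRankTwo_of_archCentralLimitExists_of_core` (F0P3a-p09 (g2)).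
The aggregator's `stub_L21` is `Kit.l21_of_A6lim stub_A6lim`. [cite: Rogawski1990, §8.4 pp. 126–127] [cite: HarishChandra1975HARRG1, §17 Lemma 17.5] -/
theorem l21_of_A6lim
    (h : ∀ (L : Type) [Field L] (α : Fin 3 → L) (w : {w : NumberField.InfinitePlace L // NumberField.InfinitePlace.IsComplex w}), Literature.NumberTheory.Rogawski1990.ArchCentralLimitExists L α w) :
    ∀ (L : Type) [Field L] (α : Fin 3 → L) (w : {w : NumberField.InfinitePlace L // NumberField.InfinitePlace.IsComplex w}), Literature.NumberTheory.Rogawski1990.ArchCentralLimitFormulaRankTwo L α w :=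
  Literature.NumberTheory.Rogawski1990.archCentralLimitFormulaRankTwo_of_archCentralLimitExists_of_core h
    (Literature.Geometry.ComplexHyperbolic.BallModel.ballCore_of_rayIdentity Literature.Geometry.ComplexHyperbolic.BallModel.rayIdentity_of_total)

/-- **(ED. 36 «A6-lim ⟸ ∅», LEAD F0P3a-plan (g12) RULING T11-29; kit term, SORRY-FREE)** — the registered print row (A6-lim) `ArchCentralLimitExists` at EVERY frame is an IN-HOUSE THEOREM:
★ p846672 `archCentralLimitExists_of_liePhiJetBounds` (F0P3a-p09 (g2): Whitney's extension theorem ★ on the closed chamber + ★ (f1) `F_Θ∘chart = u·liePhi` + the ★ W6-core values + ★ road Z)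
fed with ★ p846680 `liePhi_chamberJetBounds` ((d2): Harish-Chandra's bootstrap, Warner II Thm. 8.4.3.1, owner F0P3a-p05 ∕ F0P3-p01 over ★ (a)(b)(c)(d)(e) bricks of ROAD «A6-IV»).
The aggregator's `stub_A6lim` is `Kit.a6lim_of_jets`; registry 8 → 7. [cite: Rogawski1990, §8.4 pp. 126–127] [cite: WarnerHASSLG2, Thm. 8.4.3.1, §8.5.1 Thm. 8.5.1.1] [cite: HarishChandra1975HARRG1, §17 Lemma 17.5] -/
theorem a6lim_of_jets :
    ∀ (L : Type) [Field L] (α : Fin 3 → L) (w : {w : NumberField.InfinitePlace L // NumberField.InfinitePlace.IsComplex w}), Literature.NumberTheory.Rogawski1990.ArchCentralLimitExists L α w :=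
  Literature.NumberTheory.Rogawski1990.archCentralLimitExists_of_liePhiJetBounds Literature.Geometry.ComplexHyperbolic.BallModel.liePhi_chamberJetBounds

end Kit

end Rung0

end Summit.HodgeConjecture.HodgeConjecture.Cruxes.H413.F0U3LettersRung1

end
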